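import Literature.Topology.FourManifolds.FishtailParamsLat
import HarnessLib

/-!
# Facts about the concrete fishtail parameters, IV: the height and leg-position profiles

Infrastructure for the explicit fishtail neighbourhood (R. Gompf, *More Cappell–Shaneson spheres
are standard*, Algebr. Geom. Topol. 10 (2010), proof of Thm 2.1 and Lemma 2.2; the named fact
`Literature.Topology.FourManifolds.gompf2010_framedTwist`). For the concrete tube data
`fishTgen ε hε hε2 c ρb μ`: a two-sided bound for the first coordinate of the unified planar shell under
small displacement; the height profile `yfun` (smooth, increasing) on the wall/vertical windows
and its values on the slabs at `s₅`, `s₆`; the leg length `rL` and the leg-position profile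
`posL` (smooth, increasing) on the leg window and the slab at `s₇`.

Everything is proved; no named facts.

## References

* R. E. Gompf, *More Cappell–Shaneson spheres are standard*, Algebr. Geom. Topol. 10 (2010)
  1665–1681, proof of Thm 2.1 and Lemma 2.2. [GompfAGT2010]
-/

noncomputable section

open scoped Real Topology ContDiff
open Set Filter Real

namespace Literature.Topology.FourManifolds

/-! ### The first coordinate of the unified shell under small displacement -/

section Shell

variable {ρ : ℝ} (hρ : 0 < ρ)

include hρ in
/-- `0 ≤ footKc`. [folklore] -/
theorem footKc_nonneg (y : ℝ) : 0 ≤ footKc ρ y := by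
  have hm := footM_mem (ρ := ρ) y
  have hD := footD_pos hρ y
  have hq0 : 0 ≤ ρ / footD ρ y := by positivity
  rw [footKc]; nlinarith [hm.1, hm.2]

include hρ in
/-- **The first coordinate of the unified shell** lies in `(ρ/2, 9ρ/2)` for `-π/4 ≤ ψ < π`,
`|a| < ρ/2`. [folklore] -/
theorem fst_pathShell_mem {q : ℝ × ℝ} (h1 : -(π / 4) ≤ q.1) (h2 : q.1 < π) (ha : |q.2| < ρ / 2) :
    ρ / 2 < (pathShell ρ q).1 ∧ (pathShell ρ q).1 < 9 * ρ / 2 := by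
  have hπ := Real.pi_pos
  obtain ⟨ha1, ha2⟩ := abs_lt.1 ha
  have hA2 := pi_div_three_lt_arctan_two
  have hAh := arctan_half_lt_pi_div_six
  rcases lt_or_ge q.1 (π / 6) with hlt | hge
  · rw [pathShell_eq_flat hρ hlt, flatPt]
    have hu := flatU_mem hρ h1 (by linarith)
    have hP := abs_flatPc_le hρ (flatU ρ q.1)
    have : |q.2 * flatPc ρ (flatU ρ q.1)| < ρ / 2 := by
      rw [abs_mul]; nlinarith [abs_nonneg q.2, abs_nonneg (flatPc ρ (flatU ρ q.1))]
    obtain ⟨h3, h4⟩ := abs_lt.1 this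
    simp only
    constructor <;> nlinarith [hu.1, hu.2]
  have hA2' := Real.arctan_lt_pi_div_two (2 : ℝ)
  rcases lt_or_ge q.1 (π - Real.arctan 2) with hlt2 | hge2
  · rw [pathShell_eq_bend hρ (by linarith) hlt2.le, bendPt]
    have hR := bendR_mem hρ (ψ := q.1) (by linarith) (by linarith)
    have hs0 : 0 < Real.sin q.1 := Real.sin_pos_of_pos_of_lt_pi (by linarith) h2
    have hs1 : Real.sin q.1 ≤ 1 := Real.sin_le_one _
    simp only
    constructor <;> nlinarith [hR.1, hR.2, mul_le_mul_of_nonneg_left hs1 (by linarith [hR.1] : (0:ℝ) ≤ bendR ρ q.1 - q.2)]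
  · rw [pathShell_eq_foot hρ (by linarith), footPt]
    have hK1 := footKc_le_one hρ (footY ρ q.1)
    have hK0 := footKc_nonneg hρ (footY ρ q.1)
    have : |q.2 * footKc ρ (footY ρ q.1)| < ρ / 2 := by
      rw [abs_mul, abs_of_nonneg hK0]; nlinarith [abs_nonneg q.2]
    obtain ⟨h3, h4⟩ := abs_lt.1 this
    simp only
    constructor <;> nlinarith

end Shell

namespace FP

variable {ε : ℝ} (hε : 0 < ε) (hε2 : ε ≤ 1 / 2) {c ρb : ℝ} {μ : ℝ → ℝ}

/-! ### The height profile -/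

/-- The two branches of the height profile. [folklore] -/
def yF (ε : ℝ) (r : ℝ) : ℝ := footY ρA (angleUp (rzero ε) r)
/-- The constant `yG = cY - footY R0 (angleDown (rone ε) r)` of the fishtail data. [folklore] -/
def yG (ε : ℝ) (r : ℝ) : ℝ := cY - footY R0 (angleDown (rone ε) r)

/-- `(fishTgen ε hε hε2 c ρb μ).yfun = blendFun (stdBlend (a6 ε) (b6 ε)) (yF ε) (yG ε)`. [folklore] -/
theorem yfun_eq : (fishTgen ε hε hε2 c ρb μ).yfun = blendFun (stdBlend (a6 ε) (b6 ε)) (yF ε) (yG ε) := rfl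

/-- `(fishTgen ε hε hε2 c ρb μ).β = angleDown (rone ε)`. [folklore] -/
theorem beta_eq : (fishTgen ε hε hε2 c ρb μ).β = angleDown (rone ε) := rfl

/-- On `(s₄ - 1/10, ∞)`: `0 < α < π`, so `sin α ≠ 0`. [folklore] -/
theorem sin_alpha_pos {r : ℝ} (h : s4 ε - 1 / 10 < r) : 0 < Real.sin (angleUp (rzero ε) r) :=
  Real.sin_pos_of_pos_of_lt_pi (by linarith [alpha_gt_pi_div_two h, Real.pi_pos]) (angleUp_mem _ _).2

/-- On `(-∞, s₇ + 1/10)`… precisely for `r < r₁ + 1/√3`: `0 < β < π`, so `sin β ≠ 0`. [folklore] -/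
theorem sin_beta_pos {r : ℝ} (h : r < rone ε + 1 / Real.sqrt 3) : 0 < Real.sin (angleDown (rone ε) r) := by
  have h1 : 0 < angleDown (rone ε) r := by
    rw [← angleDown_add_inv_sqrt_three (rone ε)]; exact strictAnti_angleDown _ h
  exact Real.sin_pos_of_pos_of_lt_pi h1 (angleDown_mem _ _).2

/-- `HasDerivAt (yF ε) (ρA * (1 / Real.sin (angleUp (rzero ε) r) ^ 2) * (3 / 2 * (1 / (1 + (r - rzero ε) ^ 2)))) r`. [folklore] -/
theorem hasDerivAt_yF {r : ℝ} (hs : Real.sin (angleUp (rzero ε) r) ≠ 0) :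
    HasDerivAt (yF ε) (ρA * (1 / Real.sin (angleUp (rzero ε) r) ^ 2) * (3 / 2 * (1 / (1 + (r - rzero ε) ^ 2)))) r :=
  (hasDerivAt_footY' (ρ := ρA) hs).comp r (hasDerivAt_angleUp (rzero ε) r)

/-- The derivative of the upper height profile `yG`. [folklore] -/
theorem hasDerivAt_yG {r : ℝ} (hs : Real.sin (angleDown (rone ε) r) ≠ 0) :
    HasDerivAt (yG ε) (-(R0 * (1 / Real.sin (angleDown (rone ε) r) ^ 2) * -(3 / 2 * (1 / (1 + (r - rone ε) ^ 2))))) r :=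
  ((hasDerivAt_footY' (ρ := R0) hs).comp r (hasDerivAt_angleDown (rone ε) r)).const_sub cY

/-- `ContDiffAt ℝ ∞ (yF ε) r`. [folklore] -/
theorem contDiffAt_yF {r : ℝ} (hs : Real.sin (angleUp (rzero ε) r) ≠ 0) : ContDiffAt ℝ ∞ (yF ε) r :=
  (contDiffAt_footY (ρ := ρA) hs).comp r (contDiff_angleUp _).contDiffAt

/-- `ContDiffAt ℝ ∞ (yG ε) r`. [folklore] -/
theorem contDiffAt_yG {r : ℝ} (hs : Real.sin (angleDown (rone ε) r) ≠ 0) : ContDiffAt ℝ ∞ (yG ε) r :=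
  contDiffAt_const.sub ((contDiffAt_footY (ρ := R0) hs).comp r (contDiff_angleDown _).contDiffAt)

/-- **On `[a₆, b₆]`: `f ≤ 1/2 < 1 ≤ g`.** [folklore] -/
theorem yF_le_yG {r : ℝ} (h1 : a6 ε ≤ r) (h2 : r ≤ b6 ε) : yF ε r ≤ yG ε r := by
  unfold a6 at h1; unfold b6 at h2
  have hf := footY_alpha_le_half (ε := ε) h1 h2
  -- `g ≥ cY - R₀ (1 + 7)`: `β = π - (3/2) arctan (1/x)`, `x = r₁ - r ∈ [5, 9]`
  set x := rone ε - r with hx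
  have hx1 : 5 ≤ x := by unfold rone at hx; linarith
  have hx2 : x ≤ 9 := by unfold rone at hx; linarith
  have hx0 : 0 < x := by linarith
  have hr : r = rone ε - x := by rw [hx]; ring
  have hu1 : 1 / 9 ≤ x⁻¹ := by rw [inv_eq_one_div, le_div_iff₀ hx0]; linarith
  have hu2 : x⁻¹ ≤ 1 / 5 := by rw [inv_eq_one_div, div_le_iff₀ hx0]; linarith
  have hy : 1 / 7 ≤ 3 / 2 * Real.arctan x⁻¹ := by
    have h4 : x⁻¹ / (1 + x⁻¹ ^ 2) ≤ Real.arctan x⁻¹ := div_one_add_sq_le_arctan (inv_pos.2 hx0).le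
    have h5 : 2 / 21 ≤ x⁻¹ / (1 + x⁻¹ ^ 2) := by rw [le_div_iff₀ (by positivity)]; nlinarith
    linarith
  have hy2 : 3 / 2 * Real.arctan x⁻¹ < π / 2 := by
    have h4 : Real.arctan x⁻¹ ≤ x⁻¹ := IwaseTori.arctan_le_self (inv_pos.2 hx0).le
    linarith [Real.pi_gt_three]
  have hα0 : 0 < π - 3 / 2 * Real.arctan x⁻¹ := by linarith [Real.pi_gt_three]
  have hg := footY_le_of_le_pi_sub R0_pos hα0 le_rfl (by norm_num : (0:ℝ) < 1 / 7) hy hy2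
  rw [yF, yG, hr, angleDown_eq_pi_sub _ hx0, cY]
  rw [hr] at hf
  unfold R0 at hg ⊢
  linarith [Real.pi_gt_three]

include hε hε2 in
/-- **The height profile is smooth with positive derivative on `(s₄ - 1/10, r₁ + 1/√3)`.** [folklore] -/
theorem deriv_yfun_pos {r : ℝ} (h1 : s4 ε - 1 / 10 < r) (h2 : r < rone ε + 1 / Real.sqrt 3) :
    0 < deriv (fishTgen ε hε hε2 c ρb μ).yfun r ∧ ContDiffAt ℝ ∞ (fishTgen ε hε hε2 c ρb μ).yfun r := by
  have hsα := (sin_alpha_pos (ε := ε) h1).ne'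
  have hsβ := (sin_beta_pos (ε := ε) h2).ne'
  have hf := hasDerivAt_yF (ε := ε) hsα
  have hg := hasDerivAt_yG (ε := ε) hsβ
  have hf' : 0 < ρA * (1 / Real.sin (angleUp (rzero ε) r) ^ 2) * (3 / 2 * (1 / (1 + (r - rzero ε) ^ 2))) := by
    have := ρA_pos; positivity
  have hg' : 0 < -(R0 * (1 / Real.sin (angleDown (rone ε) r) ^ 2) * -(3 / 2 * (1 / (1 + (r - rone ε) ^ 2)))) := by
    have := R0_pos
    have : 0 < R0 * (1 / Real.sin (angleDown (rone ε) r) ^ 2) * (3 / 2 * (1 / (1 + (r - rone ε) ^ 2))) := by positivity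
    linarith
  refine ⟨?_, by rw [yfun_eq]; exact contDiffAt_blendFun (contDiff_stdBlend _ _).contDiffAt (contDiffAt_yF hsα) (contDiffAt_yG hsβ)⟩
  rw [yfun_eq]
  have hab : a6 ε < b6 ε := by unfold a6 b6; linarith
  rcases lt_or_ge r (a6 ε) with hlt | hge
  · have hev : blendFun (stdBlend (a6 ε) (b6 ε)) (yF ε) (yG ε) =ᶠ[𝓝 r] yF ε := by
      filter_upwards [(isOpen_lt continuous_id continuous_const).mem_nhds hlt] with r' hr'
      exact blendFun_of_zero (stdBlend_of_le hab (le_of_lt hr'))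
    rw [hev.deriv_eq, hf.deriv]; exact hf'
  rcases le_or_gt r (b6 ε) with hle | hgt
  · refine deriv_blendFun_pos (hasDerivAt_stdBlend _ _ r) hf hg (stdBlend_mem _ _ _).1 (stdBlend_mem _ _ _).2 ?_ hf' hg'
      (yF_le_yG hge hle)
    exact mul_nonneg Real.smoothTransition.monotone.deriv_nonneg (by rw [one_div]; exact (inv_pos.2 (by linarith)).le)
  · have hev : blendFun (stdBlend (a6 ε) (b6 ε)) (yF ε) (yG ε) =ᶠ[𝓝 r] yG ε := by
      filter_upwards [(isOpen_lt continuous_const continuous_id).mem_nhds hgt] with r' hr'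
      exact blendFun_of_one (stdBlend_of_ge hab (le_of_lt hr'))
    rw [hev.deriv_eq, hg.deriv]; exact hg'

include hε hε2 in
/-- **On the slab at `s₅`**: `yfun = footY ρ_A α ∈ [4ρ_A, 3/10]`. [folklore] -/
theorem yfun_slab5 {r : ℝ} (h : |r - s5 ε| < 1 / 10) :
    (fishTgen ε hε hε2 c ρb μ).yfun r = footY ρA (angleUp (rzero ε) r) ∧ 4 * ρA ≤ footY ρA (angleUp (rzero ε) r) ∧
      footY ρA (angleUp (rzero ε) r) ≤ 3 / 10 ∧ stdBlend (a6 ε) (b6 ε) r = 0 := by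
  obtain ⟨hα1, hα2⟩ := alpha_slab5 h
  obtain ⟨h1, h2⟩ := abs_lt.1 h
  unfold s5 at h1 h2
  have hb : stdBlend (a6 ε) (b6 ε) r = 0 := stdBlend_of_le (by unfold a6 b6; linarith) (by unfold a6; linarith)
  have hαπ := (angleUp_mem (rzero ε) r).2
  have hA3 : 0 < Real.arctan (1 / 3) := Real.arctan_pos.2 (by norm_num)
  have hA3' : Real.arctan (1 / 3) < π / 2 := Real.arctan_lt_pi_div_two _
  refine ⟨by rw [yfun_eq, blendFun_of_zero hb]; rfl, ?_, ?_, hb⟩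
  · rw [← footY_pi_sub_arctan_third ρA]
    exact footY_le_footY ρA_pos (by linarith) hα1 hαπ
  · have h5 := footY_le_of_le_pi_sub ρA_pos (ψ := angleUp (rzero ε) r) (y := 1 / 5) (y' := 1 / 5) (by linarith) hα2
      (by norm_num) le_rfl (by linarith [Real.pi_gt_three])
    unfold ρA at h5 ⊢; linarith

include hε hε2 in
/-- **On the slab at `s₆`**: `yfun = cY - footY R₀ β` with `2R₀ ≤ footY R₀ β ≤ 3/5`, `3π/4 < β < π`. [folklore] -/
theorem yfun_slab6 {r : ℝ} (h : |r - s6 ε| < 1 / 10) :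
    (fishTgen ε hε hε2 c ρb μ).yfun r = cY - footY R0 (angleDown (rone ε) r) ∧ 2 * R0 ≤ footY R0 (angleDown (rone ε) r) ∧
      footY R0 (angleDown (rone ε) r) ≤ 3 / 5 ∧ stdBlend (a6 ε) (b6 ε) r = 1 := by
  obtain ⟨hβ1, hβ2, hy⟩ := beta_slab6 h
  obtain ⟨h1, h2⟩ := abs_lt.1 h
  obtain ⟨hs1, hs2⟩ := sqrt_three_bounds
  unfold s6 rone at h1 h2
  have hb : stdBlend (a6 ε) (b6 ε) r = 1 := stdBlend_of_ge (by unfold a6 b6; linarith) (by unfold b6; linarith)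
  refine ⟨by rw [yfun_eq, blendFun_of_one hb]; rfl, ?_, hy, hb⟩
  rw [← footY_three_pi_div_four R0]
  exact footY_le_footY R0_pos (by linarith [Real.pi_pos]) hβ1.le hβ2

/-! ### The leg position -/

/-- `(fishTgen ε hε hε2 c ρb μ).rL β = c * ρb - 1 / 4 - Real.tan β`. [folklore] -/
theorem rL_eq (β : ℝ) : (fishTgen ε hε hε2 c ρb μ).rL β = c * ρb - 1 / 4 - Real.tan β := by
  show (bxH * (c * ρb) - 1 / 4 + R0 - R0 * Real.tan β) / bxH = _
  rw [bxH, R0]; ring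

/-- `rL β = s₇ - 3/100 + (tan β₇ - tan β)` when `c ρ_b = L_c`. [folklore] -/
theorem rL_eq' (hcρ : c * ρb = Lc ε) (β : ℝ) : (fishTgen ε hε hε2 c ρb μ).rL β = s7 ε - 3 / 100 + (Real.tan (beta7 ε) - Real.tan β) := by
  rw [rL_eq, hcρ, Lc]; ring

/-- The leg position map in closed form. [folklore] -/
theorem posL_eq : (fishTgen ε hε hε2 c ρb μ).posL = blendFun (stdBlend (a8 ε) (b8 ε)) (fun r ↦ (fishTgen ε hε hε2 c ρb μ).rL (angleDown (rone ε) r)) fun r ↦ r := rfl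

/-- **On `|r - s₇| ≤ 3/100`**: `|rL (β r) - (s₇ - 3/100)| ≤ (38/25) |r - s₇|`. [folklore] -/
theorem abs_rL_sub_le (hcρ : c * ρb = Lc ε) {r : ℝ} (h : |r - s7 ε| ≤ 3 / 100) :
    |(fishTgen ε hε hε2 c ρb μ).rL (angleDown (rone ε) r) - (s7 ε - 3 / 100)| ≤ 38 / 25 * |r - s7 ε| := by
  rw [rL_eq' hε hε2 hcρ, show s7 ε - 3 / 100 + (Real.tan (beta7 ε) - Real.tan (angleDown (rone ε) r)) - (s7 ε - 3 / 100) =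
    -(Real.tan (angleDown (rone ε) r) - Real.tan (beta7 ε)) by ring, abs_neg]
  exact abs_tan_beta_sub_le h

/-- `cos β ≠ 0` on `|r - s₇| ≤ 3/100`. [folklore] -/
theorem cos_beta_ne_zero {r : ℝ} (h : |r - s7 ε| ≤ 3 / 100) : Real.cos (angleDown (rone ε) r) ≠ 0 := by
  have := cos_beta_ge (ε := ε) h; exact fun h0 ↦ by rw [h0] at this; linarith

/-- The derivative of the leg radius in the shell angle. [folklore] -/
theorem hasDerivAt_rL_beta {r : ℝ} (hc : Real.cos (angleDown (rone ε) r) ≠ 0) :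
    HasDerivAt (fun r ↦ (fishTgen ε hε hε2 c ρb μ).rL (angleDown (rone ε) r))
      (-(1 / Real.cos (angleDown (rone ε) r) ^ 2 * -(3 / 2 * (1 / (1 + (r - rone ε) ^ 2))))) r := by
  have h1 := (Real.hasDerivAt_tan hc).comp r (hasDerivAt_angleDown (rone ε) r)
  have h2 := h1.const_sub (c * ρb - 1 / 4)
  refine h2.congr_of_eventuallyEq (Eventually.of_forall fun r' ↦ ?_)
  simp only [rL_eq, Function.comp]

/-- `cos β > 0` beyond `s₇ - 3/100` (`-π/2 < β < π/2`). [folklore] -/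
theorem cos_beta_pos_winU1 {r : ℝ} (h1 : s7 ε - 3 / 100 < r) : 0 < Real.cos (angleDown (rone ε) r) := by
  obtain ⟨hq1, hq2⟩ := sqrt_three_bounds
  obtain ⟨hi1, hi2⟩ := inv_sqrt_three_bounds
  unfold s7 at h1
  have hβ1 : -(π / 2) < angleDown (rone ε) r := (angleDown_mem _ _).1
  have hβ2 : angleDown (rone ε) r < π / 2 := by
    have h0 : angleDown (rone ε) r < angleDown (rone ε) (rone ε - 1 / Real.sqrt 3) :=
      strictAnti_angleDown _ (by linarith)
    have : angleDown (rone ε) (rone ε - 1 / Real.sqrt 3) = π / 2 := by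
      have h := angleDown_sub_tan (rone ε) (θ := π / 6) (by linarith [Real.pi_pos]) (by linarith [Real.pi_pos])
      rw [Real.tan_pi_div_six] at h; rw [h]; ring
    linarith
  exact Real.cos_pos_of_mem_Ioo ⟨hβ1, hβ2⟩

include hε2 in
/-- **The leg-position profile is smooth with positive derivative beyond `s₇ - 3/100`.** [folklore] -/
theorem deriv_posL_pos (hcρ : c * ρb = Lc ε) {r : ℝ} (h1 : s7 ε - 3 / 100 < r) :
    0 < deriv (fishTgen ε hε hε2 c ρb μ).posL r ∧ ContDiffAt ℝ ∞ (fishTgen ε hε hε2 c ρb μ).posL r := by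
  have hc := (cos_beta_pos_winU1 (ε := ε) h1).ne'
  have hf := hasDerivAt_rL_beta hε hε2 (c := c) (ρb := ρb) (μ := μ) (r := r) hc
  have hf' : 0 < -(1 / Real.cos (angleDown (rone ε) r) ^ 2 * -(3 / 2 * (1 / (1 + (r - rone ε) ^ 2)))) := by
    have : 0 < 1 / Real.cos (angleDown (rone ε) r) ^ 2 * (3 / 2 * (1 / (1 + (r - rone ε) ^ 2))) := by positivity
    linarith
  have hfc : ContDiffAt ℝ ∞ (fun r ↦ (fishTgen ε hε hε2 c ρb μ).rL (angleDown (rone ε) r)) r := by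
    have : (fun r ↦ (fishTgen ε hε hε2 c ρb μ).rL (angleDown (rone ε) r)) = fun r ↦ c * ρb - 1 / 4 - Real.tan (angleDown (rone ε) r) := by
      funext r'; rw [rL_eq]
    rw [this]
    exact contDiffAt_const.sub ((Real.contDiffAt_tan.2 hc).comp r (contDiff_angleDown _).contDiffAt)
  have hη := eta_lt hε hε2; have hη0 := eta_pos ε hε
  have hab : a8 ε < b8 ε := by unfold a8 b8; linarith
  refine ⟨?_, by rw [posL_eq]; exact contDiffAt_blendFun (contDiff_stdBlend _ _).contDiffAt hfc contDiffAt_id⟩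
  rw [posL_eq]
  rcases lt_or_ge r (a8 ε) with hlt | hge
  · have hev : blendFun (stdBlend (a8 ε) (b8 ε)) (fun r ↦ (fishTgen ε hε hε2 c ρb μ).rL (angleDown (rone ε) r)) (fun r ↦ r) =ᶠ[𝓝 r]
        fun r ↦ (fishTgen ε hε hε2 c ρb μ).rL (angleDown (rone ε) r) := by
      filter_upwards [(isOpen_lt continuous_id continuous_const).mem_nhds hlt] with r' hr'
      exact blendFun_of_zero (stdBlend_of_le hab (le_of_lt hr'))
    rw [hev.deriv_eq, hf.deriv]; exact hf'
  rcases le_or_gt r (b8 ε) with hle | hgt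
  · refine deriv_blendFun_pos (hasDerivAt_stdBlend _ _ r) hf (hasDerivAt_id r) (stdBlend_mem _ _ _).1 (stdBlend_mem _ _ _).2
      ?_ hf' one_pos ?_
    · exact mul_nonneg Real.smoothTransition.monotone.deriv_nonneg (by rw [one_div]; exact (inv_pos.2 (by linarith)).le)
    · -- `f ≤ s₇ - 3/100 + (38/25)(r - s₇) ≤ r` on `[a₈, b₈]`
      unfold a8 at hge; unfold b8 at hle
      have h1 := abs_rL_sub_le hε hε2 hcρ (μ := μ) (r := r) (abs_le.2 ⟨by linarith, by linarith⟩)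
      rw [abs_of_nonneg (show 0 ≤ r - s7 ε by linarith)] at h1
      have := (abs_le.1 h1).2
      linarith
  · have hev : blendFun (stdBlend (a8 ε) (b8 ε)) (fun r ↦ (fishTgen ε hε hε2 c ρb μ).rL (angleDown (rone ε) r)) (fun r ↦ r) =ᶠ[𝓝 r]
        fun r ↦ r := by
      filter_upwards [(isOpen_lt continuous_const continuous_id).mem_nhds hgt] with r' hr'
      exact blendFun_of_one (stdBlend_of_ge hab (le_of_lt hr'))
    rw [hev.deriv_eq, deriv_id'']; exact one_pos

include hε2 in
/-- **On the slab at `s₇`** (`|r - s₇| < η`): `stdBlend a₈ b₈ r = 0`, `posL = rL (β r)`, `μL (rL (β r)) = 0`,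
`-1/10 ≤ β ≤ 0`. [folklore] -/
theorem posL_slab7 (hcρ : c * ρb = Lc ε) {r : ℝ} (h : |r - s7 ε| < eta ε) :
    stdBlend (a8 ε) (b8 ε) r = 0 ∧ muL ε ((fishTgen ε hε hε2 c ρb μ).rL (angleDown (rone ε) r)) = 0 ∧
      -(1 / 10) ≤ angleDown (rone ε) r ∧ angleDown (rone ε) r ≤ 0 := by
  have hη := eta_lt hε hε2; have hη0 := eta_pos ε hε
  obtain ⟨h1, h2⟩ := abs_lt.1 h
  have h3 : |r - s7 ε| ≤ 3 / 100 := abs_le.2 ⟨by linarith, by linarith⟩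
  obtain ⟨hβ1, hβ2⟩ := beta_slab7 h3
  refine ⟨stdBlend_of_le (by unfold a8 b8; linarith) (by unfold a8; linarith), ?_, hβ1, hβ2⟩
  have h4 := abs_rL_sub_le hε hε2 hcρ (μ := μ) (r := r) h3
  have h5 := (abs_le.1 h4).2
  exact muL_of_le (by nlinarith [abs_nonneg (r - s7 ε), h.le])

end FP

end Literature.Topology.FourManifolds
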